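import Literature.MathematicalPhysics.KineticTheory.PureQuarticPathwiseEnergy
import Literature.MathematicalPhysics.KineticTheory.PureQuarticChainConfined
import Literature.MathematicalPhysics.KineticTheory.LangevinChainScaleCloseness
import HarnessLib

/-!
# The driven purely quartic chain at high energy: exact rescaling and the dissipation bound `Γ ≥ εK³` (CEHR Prop. 5.3, §5.1)

Topic `Literature/MathematicalPhysics/KineticTheory`. Fourth proof file of the provefact unit for
`CuneoEckmannHairerReyBellet2018_pureQuarticChain` (`PureQuarticChainNESS.lean`; CEHR 2018 =
Cuneo–Eckmann–Hairer–Rey-Bellet, EJP **23** (2018) no. 55). The heart of the Lyapunov condition H2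
(Thm 5.1) is Prop. 5.3: at high energy `E = K⁴` the dissipation `Γ = γ∫₀^τ ∑_b p_b²` over the
window `τ = λE^{1/ℓ_i - 1/2} = λ/K` (`ℓ_i = ℓ_p = 4`: §5.1 only, "such a distinction is not
necessary") is at least `ε E τ K = ε K³`, because the rescaled dynamics (5.7)–(5.8) is close to the
limiting Hamiltonian chain (5.10), which dissipates (Prop. 5.14). This is the analogue of
`LangevinChainScaleCloseness.lean` (`pinnedChain_dissipation_ge_interaction`) for the purely quartic
chain, PIPELINE-AGNOSTIC (any continuous solution `z` of the integral equation
`z(t) = x + (0,η(t)) + ∫₀ᵗ Y(z)`), and simpler because the rescaling is EXACT: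

* `pureQuarticChain_drift_eq_limitChain_add` — the Hamiltonian of `pureQuarticChain μ γ'` being
  that of the limiting chain `limitChain μ 1` (`pureQuarticChain_hamiltonian_eq_limitChain`,
  `PureQuarticChainConfined.lean`; `LangevinChainLimitFlow.lean`), its drift is the limit drift plus
  the friction `-(γ' w_i p_i)_i`;
* `pureQuarticChain_inv_smul_rescale_drift`, `pureQuarticChain_scalePath_isIntegralSolutionOn` —
  **mechanical similarity of the DRIVEN chain**: if `z` solves the equation of `pureQuarticChain μ γ`
  with noise `η` on `[0, Λ/K]`, the rescaled path `z̃(σ) = rescale K (z(σ/K))` solves the equation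
  of `pureQuarticChain μ (γ/K)` with noise `K⁻²η(σ/K)` on `[0, Λ]` (CEHR (5.8) with NO error term);
* `pureQuarticChain_scalePath_bounds` — bounds along `z̃` from the energy ceiling `8K⁴` of
  `PureQuarticPathwiseEnergy.lean` (momenta `≤ 5`, bond stretches `≤ 32`, `μq̃² ≤ μ + 32`,
  `|p̃ - K⁻²ȳ| ≤ 1/K` for a noise path of size `√K`);
* `pureQuarticChain_dissipation_ge` — **CEHR Prop. 5.3 for the purely quartic chain, PROVED**
  (`μ, γ > 0`, `N ≥ 1`): there are `K₀ ≥ 1`, `ε > 0` such that for `K ≥ K₀`, every `x` with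
  `K⁴ ≤ H(x) ≤ 2K⁴`, every continuous noise path with `‖η‖ ≤ √K` on `[0, 1/K]` and every continuous
  solution `z`, `γ ∫₀^{1/K} ∑_i w_i ȳ_i² ≥ ε K³` (Grönwall against the truncated limit flow
  `limitChainFlow μ 1` on the region `scaleRegion`, `IsIntegralSolutionOn.norm_sub_le_mul_exp`,
  and the uniform dissipation `exists_le_limitDissipation` of Prop. 5.14).

Everything is PROVED; no definition, no named fact.

## References

* N. Cuneo, J.-P. Eckmann, M. Hairer, L. Rey-Bellet, EJP **23** (2018) no. 55 (arXiv:1712.09413),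
  §5 Prop. 5.3, Lemma 5.8, §5.1 eqs. (5.7)–(5.10), Lemma 5.13, Prop. 5.14, Lemma 5.17.
* L. D. Landau, E. M. Lifshitz, *Mechanics* (3rd ed., 1976), §10.
-/

noncomputable section

open MeasureTheory Filter Topology Set Metric intervalIntegral
open scoped NNReal

namespace Literature.MathematicalPhysics.KineticTheory.HeatConduction

open Literature.Analysis.ODE OscillatorChain

variable {N : ℕ}

/-! ### The purely quartic chain and the limiting quartic chain -/

section LimitRelation

variable (μ : ℝ)

/-- The Hamiltonian of the purely quartic chain does not depend on the friction. [folklore] -/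
theorem pureQuarticChain_hamiltonian_eq (γ γ' : ℝ) (N : ℕ) :
    (pureQuarticChain μ γ').hamiltonian N = (pureQuarticChain μ γ).hamiltonian N := rfl

/-- The drift of the purely quartic chain with friction `γ'` is the limit drift plus the friction
term `(0, -(γ' w_i p_i)_i)`. [cite: CuneoEckmannHairerReyBellet2018, §5.1 eq. (5.8)] -/
theorem pureQuarticChain_drift_eq_limitChain_add (γ' : ℝ) (N : ℕ) (z : PhaseSpace N) :
    (pureQuarticChain μ γ').drift N z = (limitChain μ 1).drift N z +
      ((0 : Fin N → ℝ), fun i => -(γ' * bathWeight N i * z.2 i)) := by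
  have hγ0 : (limitChain μ 1).γ = 0 := rfl
  have hγ' : (pureQuarticChain μ γ').γ = γ' := rfl
  ext i
  · simp [OscillatorChain.drift]
  · simp only [OscillatorChain.drift, Prod.snd_add, Pi.add_apply, hγ0, hγ', zero_mul, sub_zero,
      pureQuarticChain_hamiltonian_eq_limitChain μ γ' N]
    ring

/-- The friction term is small: `‖Y_{γ'}(z) - Ŷ(z)‖ ≤ 2γ' Cp` if `|p_i| ≤ Cp` (`γ' ≥ 0`). [folklore] -/
theorem norm_pureQuarticChain_drift_sub_limitChain_le {γ' Cp : ℝ} (hγ' : 0 ≤ γ') (hCp : 0 ≤ Cp)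
    (N : ℕ) {z : PhaseSpace N} (hz : ∀ i, |z.2 i| ≤ Cp) :
    ‖(pureQuarticChain μ γ').drift N z - (limitChain μ 1).drift N z‖ ≤ 2 * γ' * Cp := by
  rw [pureQuarticChain_drift_eq_limitChain_add μ γ' N z, add_sub_cancel_left, Prod.norm_def, norm_zero,
    max_le_iff]
  refine ⟨by positivity, (pi_norm_le_iff_of_nonneg (by positivity)).2 fun i => ?_⟩
  have hw0 : 0 ≤ bathWeight N i := by unfold bathWeight; split_ifs <;> norm_num
  have hw2 : bathWeight N i ≤ 2 := by unfold bathWeight; split_ifs <;> norm_num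
  rw [Real.norm_eq_abs, abs_neg, abs_mul, abs_mul, abs_of_nonneg hγ', abs_of_nonneg hw0]
  calc γ' * bathWeight N i * |z.2 i| ≤ γ' * 2 * Cp :=
        mul_le_mul (mul_le_mul_of_nonneg_left hw2 hγ') (hz i) (abs_nonneg _) (by positivity)
    _ = 2 * γ' * Cp := by ring

end LimitRelation

/-! ### Mechanical similarity of the driven chain: the rescaled integral equation -/

section Rescaling

variable {μ γ : ℝ}

/-- `rescale a = S_{a⁻¹}` (`rescale a (q,p) = (a⁻¹q, a⁻²p)`, `S_b(q,p) = (bq, b²p)`). [folklore] -/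
theorem rescale_eq_quarticDilation (a : ℝ) (z : PhaseSpace N) : rescale a z = quarticDilation a⁻¹ z := by
  ext i <;> simp [rescale, quarticDilation, inv_pow]

/-- Energies scale by `K⁻⁴`: `H(rescale K x) = K⁻⁴ H(x)`. [cite: CuneoEckmannHairerReyBellet2018, §5.1 eq. (5.7)] -/
theorem pureQuarticChain_hamiltonian_rescale (μ γ K : ℝ) (N : ℕ) (x : PhaseSpace N) :
    (pureQuarticChain μ γ).hamiltonian N (rescale K x) = (K ^ 4)⁻¹ * (pureQuarticChain μ γ).hamiltonian N x := by
  rw [rescale_eq_quarticDilation, pureQuarticChain_hamiltonian_quarticDilation, inv_pow]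

/-- **The drift rescales EXACTLY to the drift with friction `γ/K`**:
`K⁻¹ • rescale K (Y_γ(z)) = Y_{γ/K}(rescale K z)` for the purely quartic chain (`K ≠ 0`; the force
is homogeneous of degree `3`). [cite: CuneoEckmannHairerReyBellet2018, §5.1 eq. (5.8)] -/
theorem pureQuarticChain_inv_smul_rescale_drift {K : ℝ} (hK : K ≠ 0) (N : ℕ) (z : PhaseSpace N) :
    K⁻¹ • rescale K ((pureQuarticChain μ γ).drift N z) =
      (pureQuarticChain μ (γ / K)).drift N (rescale K z) := by
  have hF : ∀ i, partialQ i ((pureQuarticChain μ (γ / K)).hamiltonian N) (rescale K z) =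
      (K ^ 3)⁻¹ * partialQ i ((pureQuarticChain μ γ).hamiltonian N) z := fun i => by
    rw [pureQuarticChain_hamiltonian_eq μ γ (γ / K) N, rescale_eq_quarticDilation,
      pureQuarticChain_partialQ_hamiltonian_quarticDilation μ γ (inv_ne_zero hK) N i z, inv_pow]
  have hγ : (pureQuarticChain μ γ).γ = γ := rfl
  have hγ' : (pureQuarticChain μ (γ / K)).γ = γ / K := rfl
  ext i
  · simp only [Prod.smul_fst, Pi.smul_apply, rescale_fst, OscillatorChain.drift, smul_eq_mul, rescale_snd]
    rw [sq]
    ring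
  · simp only [Prod.smul_snd, Pi.smul_apply, rescale_snd, OscillatorChain.drift, smul_eq_mul, hF, hγ, hγ']
    field_simp

/-- **The rescaled integral equation (mechanical similarity of the driven chain)**: if
`z(s) = x + (0, η(s)) + ∫₀ˢ Y_γ(z)` on `[0, Λ/K]` (`K > 0`, `z` continuous), then the rescaled path
`z̃(σ) = rescale K (z(σ/K))` solves on `[0, Λ]` the SAME KIND of equation for the chain with
friction `γ/K` and the noise `K⁻²η(σ/K)`:
`z̃(σ) = rescale K x + (0, K⁻²η(σ/K)) + ∫₀^σ Y_{γ/K}(z̃(σ')) dσ'` (CEHR (5.8), here without any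
error term). [cite: CuneoEckmannHairerReyBellet2018, §5.1 eq. (5.8)] -/
theorem pureQuarticChain_scalePath_isIntegralSolutionOn {K : ℝ} (hK : 0 < K) (N : ℕ)
    {x : PhaseSpace N} {η : ℝ → Fin N → ℝ} {z : ℝ → PhaseSpace N} (hzc : Continuous z) {Λ : ℝ}
    (hz : IsIntegralSolutionOn ((pureQuarticChain μ γ).drift N)
      (fun s => x + ((0 : Fin N → ℝ), η s)) z (Λ / K)) :
    IsIntegralSolutionOn ((pureQuarticChain μ (γ / K)).drift N)
      (fun σ => rescale K x + ((0 : Fin N → ℝ), fun i => (K ^ 2)⁻¹ * η (σ / K) i))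
      (scalePath K z) Λ := by
  intro σ hσ
  set P := pureQuarticChain μ γ with hP
  have hYc : Continuous (P.drift N) := (pureQuarticChain_contDiff_drift μ γ N (n := 0)).continuous
  have hσK : σ / K ∈ Icc 0 (Λ / K) := ⟨div_nonneg hσ.1 hK.le, div_le_div_of_nonneg_right hσ.2 hK.le⟩
  unfold scalePath
  rw [hz (σ / K) hσK, rescale_add, rescale_add]
  have h1 : rescale K (((0 : Fin N → ℝ), η (σ / K)) : PhaseSpace N) =
      ((0 : Fin N → ℝ), fun i => (K ^ 2)⁻¹ * η (σ / K) i) := by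
    ext i <;> simp [rescale]
  have h2 : rescale K (∫ r in (0 : ℝ)..σ / K, P.drift N (z r)) =
      ∫ r in (0 : ℝ)..σ / K, rescale K (P.drift N (z r)) := by
    have hint : IntervalIntegrable (fun r => P.drift N (z r)) volume 0 (σ / K) :=
      (hYc.comp hzc).intervalIntegrable _ _
    rw [← rescaleL_apply, ← (rescaleL K).intervalIntegral_comp_comm hint]
    simp only [rescaleL_apply]
  have h3 : ∫ r in (0 : ℝ)..σ, (pureQuarticChain μ (γ / K)).drift N (rescale K (z (r / K))) =
      ∫ r in (0 : ℝ)..σ / K, rescale K (P.drift N (z r)) := by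
    have h4 : ∀ r, (pureQuarticChain μ (γ / K)).drift N (rescale K (z (r / K))) =
        K⁻¹ • rescale K (P.drift N (z (r / K))) := fun r =>
      (pureQuarticChain_inv_smul_rescale_drift hK.ne' N _).symm
    simp_rw [h4]
    rw [intervalIntegral.integral_smul, intervalIntegral.inv_smul_integral_comp_div
      (f := fun r => rescale K (P.drift N (z r))), zero_div]
  simp only
  rw [h1, h2, ← h3]

end Rescaling

/-! ### Bounds along the rescaled driven path -/

section Bounds

variable {μ γ : ℝ}

/-- **Bounds along the rescaled driven path** `z̃(σ) = rescale K (z(σ/K))`, `σ ∈ [0, 1]`, for the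
purely quartic chain (`μ > 0`, `γ ≥ 0`, `K ≥ max(1, C)`, `C = pureQuarticEnergyConst`), a start
`H(x) ≤ 2K⁴`, a continuous noise path with `‖η‖ ≤ √K` on `[0, 1/K]` and a continuous solution `z`
of the integral equation: by the energy ceiling `H(y) ≤ 8K⁴` of the smooth part, the rescaled
momenta are `≤ 5`, the rescaled bond stretches `≤ 32`, `μ q̃_i² ≤ μ + 32`, and the rescaled momentum
differs from the rescaled smooth momentum `K⁻²ȳ` by at most `1/K` (CEHR (5.9): "`z̃_σ ∈ K̃_E`" on
the event `Ã`; here pathwise). [cite: CuneoEckmannHairerReyBellet2018, Lemma 5.10 and eq. (5.9)] -/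
theorem pureQuarticChain_scalePath_bounds (hμ : 0 < μ) (hγ : 0 ≤ γ) {K : ℝ} (hK : 1 ≤ K)
    (hKC : pureQuarticEnergyConst μ γ N ≤ K) {x : PhaseSpace N}
    (hx : (pureQuarticChain μ γ).hamiltonian N x ≤ 2 * K ^ 4)
    {η : ℝ → Fin N → ℝ} (hM : ∀ s ∈ Icc 0 (1 / K), ‖η s‖ ≤ Real.sqrt K)
    {z : ℝ → PhaseSpace N} (hzc : Continuous z)
    (hz : IsIntegralSolutionOn ((pureQuarticChain μ γ).drift N)
      (fun s => x + ((0 : Fin N → ℝ), η s)) z (1 / K))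
    {σ : ℝ} (hσ : σ ∈ Icc 0 1) :
    (∀ i, |(scalePath K z σ).2 i| ≤ 5) ∧
    (∀ i : Fin N, ∀ h : i.val + 1 < N,
        |(scalePath K z σ).1 ⟨i.val + 1, h⟩ - (scalePath K z σ).1 i| ≤ 32) ∧
    (∀ i, μ * (scalePath K z σ).1 i ^ 2 ≤ μ + 32) ∧
    (∀ i, |(scalePath K z σ).2 i -
        (K ^ 2)⁻¹ * (z (σ / K) - ((0 : Fin N → ℝ), η (σ / K))).2 i| ≤ 1 / K) := by
  set P := pureQuarticChain μ γ with hP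
  set s := σ / K with hs
  have hK0 : 0 < K := by linarith
  have hsI : s ∈ Icc 0 (1 / K) := ⟨div_nonneg hσ.1 hK0.le, div_le_div_of_nonneg_right hσ.2 hK0.le⟩
  have hsqrt1 : 1 ≤ Real.sqrt K := by rw [Real.le_sqrt (by norm_num) hK0.le]; simpa using hK
  have hsqrtK : Real.sqrt K ≤ K := by
    rw [Real.sqrt_le_left hK0.le]; nlinarith
  have hMT : pureQuarticEnergyConst μ γ N * Real.sqrt K * (1 / K) ≤ K := by
    have hC0 := pureQuarticEnergyConst_nonneg hμ γ N
    calc pureQuarticEnergyConst μ γ N * Real.sqrt K * (1 / K)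
        ≤ K * K * (1 / K) := by
          refine mul_le_mul_of_nonneg_right (mul_le_mul hKC hsqrtK (Real.sqrt_nonneg _) hK0.le) ?_
          positivity
      _ = K := by field_simp
  set y := z s - ((0 : Fin N → ℝ), η s) with hy
  have hceil : P.hamiltonian N y ≤ 8 * K ^ 4 :=
    pureQuarticChain_hamiltonian_smoothPart_le_ceiling hμ hγ N hK hx hzc hM hMT hz s hsI
  have hy1 : ∀ j, y.1 j = (z s).1 j := fun j => by simp [hy]
  have hy2 : ∀ j, (z s).2 j = y.2 j + η s j := fun j => by simp [hy]
  have hzs1 : ∀ j, (scalePath K z σ).1 j = K⁻¹ * (z s).1 j := fun j => rfl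
  have hzs2 : ∀ j, (scalePath K z σ).2 j = (K ^ 2)⁻¹ * (z s).2 j := fun j => rfl
  have hηi : ∀ j, |η s j| ≤ Real.sqrt K := fun j =>
    (show |η s j| ≤ ‖η s‖ by rw [← Real.norm_eq_abs]; exact norm_le_pi_norm (η s) j).trans (hM s hsI)
  have hmom : ∀ i, |y.2 i| ≤ 4 * K ^ 2 := fun i => pureQuarticChain_abs_momentum_le_of_le hμ.le γ N hceil i
  refine ⟨fun i => ?_, fun i h => ?_, fun i => ?_, fun i => ?_⟩
  · -- momenta
    rw [hzs2, hy2, abs_mul, abs_of_nonneg (by positivity)]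
    have h4 : |y.2 i + η s i| ≤ 4 * K ^ 2 + K ^ 2 := by
      calc |y.2 i + η s i| ≤ |y.2 i| + |η s i| := abs_add_le _ _
        _ ≤ 4 * K ^ 2 + K ^ 2 := by
            refine add_le_add (hmom i) ((hηi i).trans (hsqrtK.trans ?_))
            nlinarith
    calc (K ^ 2)⁻¹ * |y.2 i + η s i| ≤ (K ^ 2)⁻¹ * (4 * K ^ 2 + K ^ 2) :=
          mul_le_mul_of_nonneg_left h4 (by positivity)
      _ = 5 := by field_simp; ring
  · -- bond stretches
    rw [hzs1, hzs1, ← mul_sub, ← hy1, ← hy1]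
    have h32 : (32 : ℝ) = max 1 32 := (max_eq_right (by norm_num)).symm
    rw [h32]
    refine abs_le_max_one_of_pow_four_le ?_
    have hb := pureQuarticChain_bond_le_hamiltonian hμ.le γ N y (i := i) (j := ⟨i.val + 1, h⟩) rfl
    have hb' : (y.1 ⟨i.val + 1, h⟩ - y.1 i) ^ 4 ≤ 32 * K ^ 4 := by linarith
    rw [mul_pow, inv_pow]
    calc (K ^ 4)⁻¹ * (y.1 ⟨i.val + 1, h⟩ - y.1 i) ^ 4 = (y.1 ⟨i.val + 1, h⟩ - y.1 i) ^ 4 / K ^ 4 := by ring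
      _ ≤ 32 * K ^ 4 / K ^ 4 := div_le_div_of_nonneg_right hb' (by positivity)
      _ = 32 := by field_simp
  · -- `μ q̃²`
    rw [hzs1, ← hy1]
    have hU := pureQuarticChain_U_le_hamiltonian hμ.le γ N y i
    have hl4 : μ * (K⁻¹ * y.1 i) ^ 4 ≤ 32 := by
      rw [mul_pow, inv_pow]
      have : μ * y.1 i ^ 4 ≤ 32 * K ^ 4 := by nlinarith
      calc μ * ((K ^ 4)⁻¹ * y.1 i ^ 4) = μ * y.1 i ^ 4 / K ^ 4 := by ring
        _ ≤ 32 * K ^ 4 / K ^ 4 := div_le_div_of_nonneg_right this (by positivity)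
        _ = 32 := by field_simp
    have hsq : (K⁻¹ * y.1 i) ^ 2 ≤ 1 + (K⁻¹ * y.1 i) ^ 4 := by nlinarith [sq_nonneg ((K⁻¹ * y.1 i) ^ 2 - 1)]
    nlinarith [mul_le_mul_of_nonneg_left hsq hμ.le]
  · -- rescaled momentum vs rescaled smooth momentum
    rw [hzs2, hy2]
    have : (K ^ 2)⁻¹ * (y.2 i + η s i) - (K ^ 2)⁻¹ * y.2 i = (K ^ 2)⁻¹ * η s i := by ring
    rw [this, abs_mul, abs_of_nonneg (by positivity)]
    calc (K ^ 2)⁻¹ * |η s i| ≤ (K ^ 2)⁻¹ * K := mul_le_mul_of_nonneg_left ((hηi i).trans hsqrtK) (by positivity)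
      _ = 1 / K := by field_simp

/-- **Bounds along the limit flow** started in the shell `Ĥ ≤ 2` (`μ ≥ 0`, coupling `β = 1`):
momenta `≤ 5/2 ≤ 5`, bond stretches `≤ 8 ≤ 32`, `μ q̂² ≤ μ + 8` — by exact energy conservation.
[folklore] -/
theorem limitChainFlow_one_bounds (hμ : 0 ≤ μ) (N : ℕ) {R : ℝ} (hR : 0 < R)
    {x : PhaseSpace N} (hx : (limitChain μ 1).hamiltonian N x ≤ 2) (σ : ℝ) :
    (∀ i, |(limitChainFlow μ 1 N hR x σ).2 i| ≤ 5) ∧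
    (∀ i : Fin N, ∀ h : i.val + 1 < N,
        |(limitChainFlow μ 1 N hR x σ).1 ⟨i.val + 1, h⟩ - (limitChainFlow μ 1 N hR x σ).1 i| ≤ 32) ∧
    (∀ i, μ * (limitChainFlow μ 1 N hR x σ).1 i ^ 2 ≤ μ + 32) := by
  set w := limitChainFlow μ 1 N hR x σ with hw
  have hH : (limitChain μ 1).hamiltonian N w ≤ 2 := by
    rw [hw, limitChain_hamiltonian_limitChainFlow]; exact hx
  refine ⟨fun i => ?_, fun i h => ?_, fun i => ?_⟩
  · have := abs_limitChainFlow_snd_le N hR hμ zero_le_one x σ i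
    linarith
  · have hb := limitChain_bond_le_hamiltonian hμ zero_le_one N w (i := i) (j := ⟨i.val + 1, h⟩) rfl
    have h32 : (32 : ℝ) = max 1 32 := (max_eq_right (by norm_num)).symm
    rw [h32]
    refine abs_le_max_one_of_pow_four_le ?_
    linarith
  · have hU := limitChain_U_le_hamiltonian hμ zero_le_one N w i
    have hsq : w.1 i ^ 2 ≤ 1 + w.1 i ^ 4 := by nlinarith [sq_nonneg (w.1 i ^ 2 - 1)]
    nlinarith [mul_le_mul_of_nonneg_left hsq hμ]

end Bounds

/-! ### CEHR Proposition 5.3: the dissipation over the window `1/K` is at least `εK³` -/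

section Main

variable {μ γ : ℝ}

set_option maxHeartbeats 1600000 in
/-- **Cuneo–Eckmann–Hairer–Rey-Bellet 2018, Proposition 5.3 for the purely quartic chain (§5.1,
`ℓ_i = ℓ_p = 4`), PROVED as a deterministic statement about bounded noise paths**: for `μ, γ > 0`
and `N ≥ 1` there are `K₀ ≥ 1` and `ε > 0` such that for every `K ≥ K₀`, every start `x` in the
energy shell `K⁴ ≤ H(x) ≤ 2K⁴`, every continuous noise path with `‖η‖ ≤ √K` on the window
`[0, 1/K]`, and every continuous solution `z` of `z(t) = x + (0,η(t)) + ∫₀ᵗ Y(z)`, the dissipation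
of the smooth part satisfies `γ ∫₀^{1/K} ∑_i w_i ȳ_i(s)² ds ≥ ε K³`. Proof: rescale
(`pureQuarticChain_scalePath_isIntegralSolutionOn`); the rescaled path solves the limit equation
up to the friction `γ/K` and the noise `≤ 1/K` and stays in the region `S(5, 32, μ+32)`
(`pureQuarticChain_scalePath_bounds`); the reference limit solution from the rescaled point stays
there too and dissipates at least `ε₁` (`exists_le_limitDissipation`, Prop. 5.14); Grönwall
(`IsIntegralSolutionOn.norm_sub_le_mul_exp`, Lemma 5.8) makes the two `O(1/K)`-close, so the
rescaled path dissipates at least `ε₁/4` for `K` large, i.e. `(γε₁/4)K³` in the original variables.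
[cite: CuneoEckmannHairerReyBellet2018, Prop 5.3, Prop 5.14 and Lemma 5.17] -/
theorem pureQuarticChain_dissipation_ge (hμ : 0 < μ) (hγ : 0 < γ) (hN : 0 < N) :
    ∃ K₀ ε : ℝ, 1 ≤ K₀ ∧ 0 < ε ∧ ∀ K : ℝ, K₀ ≤ K → ∀ x : PhaseSpace N,
      K ^ 4 ≤ (pureQuarticChain μ γ).hamiltonian N x →
      (pureQuarticChain μ γ).hamiltonian N x ≤ 2 * K ^ 4 →
      ∀ η : ℝ → Fin N → ℝ, Continuous η → (∀ s ∈ Icc 0 (1 / K), ‖η s‖ ≤ Real.sqrt K) →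
      ∀ z : ℝ → PhaseSpace N, Continuous z →
        IsIntegralSolutionOn ((pureQuarticChain μ γ).drift N)
          (fun s => x + ((0 : Fin N → ℝ), η s)) z (1 / K) →
        ε * K ^ 3 ≤ γ * ∫ s in (0 : ℝ)..1 / K, ∑ i, bathWeight N i *
          (z s - ((0 : Fin N → ℝ), η s)).2 i ^ 2 := by
  -- the constants
  set C := pureQuarticEnergyConst μ γ N with hC
  have hC0 : 0 ≤ C := pureQuarticEnergyConst_nonneg hμ γ N
  set Cp : ℝ := 5 with hCp
  set Cd : ℝ := 32 with hCd
  set Cq : ℝ := μ + 32 with hCq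
  have hCp0 : (0 : ℝ) ≤ Cp := by norm_num
  have hCq0 : 0 ≤ Cq := by positivity
  set L : ℝ := 1 + 3 * Cq + 12 * 1 * Cd ^ 2 with hL
  have hL0 : 0 ≤ L := by positivity
  set ρ : ℝ := max 1 (8 / μ) with hρ
  have hρ0 : 0 ≤ ρ := le_max_of_le_left zero_le_one
  set R : ℝ := Real.sqrt (N * ((ρ + (2 + 1 / 2) * 1) ^ 2 + (2 + 1 / 2) ^ 2)) + 1 with hRdef
  have hR : 0 < R := by positivity
  have hRad : N * ((ρ + (2 + 1 / 2) * 1) ^ 2 + (2 + 1 / 2) ^ 2) ≤ R ^ 2 := by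
    have h0 : 0 ≤ (N : ℝ) * ((ρ + (2 + 1 / 2) * 1) ^ 2 + (2 + 1 / 2) ^ 2) := by positivity
    have h1 := Real.sq_sqrt h0
    nlinarith [Real.sqrt_nonneg ((N : ℝ) * ((ρ + (2 + 1 / 2) * 1) ^ 2 + (2 + 1 / 2) ^ 2))]
  obtain ⟨ε₁, hε₁, hF⟩ := exists_le_limitDissipation (lam := μ) (β := 1) N hR hμ.le one_pos hN one_pos
    (h₀ := 2) (h₁ := 1) (ρ := ρ) one_pos hRad
  set Cpert : ℝ := 2 * γ * Cp with hCpert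
  have hCpert0 : 0 ≤ Cpert := by positivity
  set D₀ : ℝ := (1 + Cpert) * Real.exp (L * 1) + 1 with hD₀
  have hD₀0 : 0 ≤ D₀ := by positivity
  set K₀ : ℝ := max (max 1 C) (8 * D₀ ^ 2 / ε₁ + 1) with hK₀
  refine ⟨K₀, γ * ε₁ / 4, (le_max_left _ _).trans (le_max_left _ _), by positivity, ?_⟩
  intro K hK x hx1 hx2 η hη hM z hzc hz
  have hK1 : 1 ≤ K := ((le_max_left _ _).trans (le_max_left _ _)).trans hK
  have hKC : C ≤ K := ((le_max_right _ _).trans (le_max_left _ _)).trans hK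
  have hK0 : 0 < K := by linarith
  have hKD : 8 * D₀ ^ 2 / ε₁ ≤ K := by
    have := (le_max_right _ _).trans hK
    linarith
  set P := pureQuarticChain μ γ with hP
  set xs := rescale K x with hxs
  set zs := scalePath K z with hzs
  set Yhat := (limitChain μ 1).drift N with hYhat
  set YK := (pureQuarticChain μ (γ / K)).drift N with hYK
  -- (a) the rescaled integral equation on `[0, 1]`
  have hzsc : Continuous zs := continuous_scalePath K hzc
  have hzsIE : IsIntegralSolutionOn YK
      (fun σ => xs + ((0 : Fin N → ℝ), fun i => (K ^ 2)⁻¹ * η (σ / K) i)) zs 1 :=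
    pureQuarticChain_scalePath_isIntegralSolutionOn hK0 N hzc (Λ := 1) hz
  -- (b) bounds along the rescaled path, membership in the region, the perturbation
  have hbd := fun σ (hσ : σ ∈ Icc (0 : ℝ) 1) =>
    pureQuarticChain_scalePath_bounds (N := N) hμ hγ.le hK1 hKC hx2 hM hzc hz hσ
  have hmem : ∀ σ ∈ Icc (0 : ℝ) 1, zs σ ∈ scaleRegion μ N Cp Cd Cq := fun σ hσ =>
    ⟨(hbd σ hσ).1, (hbd σ hσ).2.1, (hbd σ hσ).2.2.1⟩
  have hpert : ∀ σ ∈ Icc (0 : ℝ) 1, ‖YK (zs σ) - Yhat (zs σ)‖ ≤ Cpert / K := by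
    intro σ hσ
    have h := norm_pureQuarticChain_drift_sub_limitChain_le μ (γ' := γ / K) (by positivity) hCp0 N
      (hbd σ hσ).1
    rw [hCpert]
    calc ‖YK (zs σ) - Yhat (zs σ)‖ ≤ 2 * (γ / K) * Cp := h
      _ = 2 * γ * Cp / K := by ring
  -- (c) the rescaled path solves the limit equation with the forcing `G`
  have hYKc : Continuous fun r => YK (zs r) :=
    (pureQuarticChain_contDiff_drift μ (γ / K) N (n := 0)).continuous.comp hzsc
  have hYh : Continuous fun r => Yhat (zs r) := (limitChain_contDiff_drift μ 1 N (n := 0)).continuous.comp hzsc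
  set G : ℝ → PhaseSpace N := fun σ => xs + ((0 : Fin N → ℝ), fun i => (K ^ 2)⁻¹ * η (σ / K) i) +
    ∫ r in (0 : ℝ)..σ, (YK (zs r) - Yhat (zs r)) with hG
  have hGIE : IsIntegralSolutionOn Yhat G zs 1 := by
    intro σ hσ
    rw [hG]
    simp only
    rw [intervalIntegral.integral_sub (hYKc.intervalIntegrable _ _) (hYh.intervalIntegrable _ _), hzsIE σ hσ]
    beta_reduce
    abel
  have hGδ : ∀ σ ∈ Icc (0 : ℝ) 1, ‖G σ - xs‖ ≤ (1 + Cpert) / K := by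
    intro σ hσ
    have e : G σ - xs = ((0 : Fin N → ℝ), fun i => (K ^ 2)⁻¹ * η (σ / K) i) +
        ∫ r in (0 : ℝ)..σ, (YK (zs r) - Yhat (zs r)) := by
      rw [hG]; simp only; abel
    rw [e]
    have h1 : ‖(((0 : Fin N → ℝ), fun i => (K ^ 2)⁻¹ * η (σ / K) i) : PhaseSpace N)‖ ≤ 1 / K := by
      rw [Prod.norm_def, norm_zero, max_le_iff]
      refine ⟨by positivity, (pi_norm_le_iff_of_nonneg (by positivity)).2 fun i => ?_⟩
      have := (hbd σ hσ).2.2.2 i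
      have hcomp : (scalePath K z σ).2 i -
          (K ^ 2)⁻¹ * (z (σ / K) - ((0 : Fin N → ℝ), η (σ / K))).2 i = (K ^ 2)⁻¹ * η (σ / K) i := by
        simp only [scalePath, rescale_snd, Prod.snd_sub, Pi.sub_apply]
        ring
      rw [hcomp] at this
      rwa [Real.norm_eq_abs]
    have h2 : ‖∫ r in (0 : ℝ)..σ, (YK (zs r) - Yhat (zs r))‖ ≤ Cpert / K * |σ - 0| :=
      intervalIntegral.norm_integral_le_of_norm_le_const fun r hr => by
        rw [uIoc_of_le hσ.1] at hr
        exact hpert r ⟨hr.1.le, hr.2.trans hσ.2⟩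
    rw [sub_zero, abs_of_nonneg hσ.1] at h2
    calc ‖(((0 : Fin N → ℝ), fun i => (K ^ 2)⁻¹ * η (σ / K) i) : PhaseSpace N) +
          ∫ r in (0 : ℝ)..σ, (YK (zs r) - Yhat (zs r))‖
        ≤ 1 / K + Cpert / K * σ := (norm_add_le _ _).trans (add_le_add h1 h2)
      _ ≤ 1 / K + Cpert / K * 1 := by gcongr; exact hσ.2
      _ = (1 + Cpert) / K := by ring
  -- (d) the reference solution of the limit system
  have hHxs : (limitChain μ 1).hamiltonian N xs ≤ 2 := by
    rw [← pureQuarticChain_hamiltonian_eq_limitChain μ γ N, hxs, pureQuarticChain_hamiltonian_rescale]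
    have hK4 : 0 < K ^ 4 := by positivity
    rw [inv_mul_le_iff₀ hK4]
    linarith
  have hHxs1 : 1 ≤ (limitChain μ 1).hamiltonian N xs := by
    rw [← pureQuarticChain_hamiltonian_eq_limitChain μ γ N, hxs, pureQuarticChain_hamiltonian_rescale]
    have hK4 : 0 < K ^ 4 := by positivity
    rw [le_inv_mul_iff₀ hK4]
    linarith
  have hxsρ : ∀ i, |xs.1 i| ≤ ρ := by
    intro i
    have hU := limitChain_U_le_hamiltonian hμ.le zero_le_one N xs i
    have h4 : xs.1 i ^ 4 ≤ 8 / μ := by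
      rw [le_div_iff₀ hμ]; nlinarith
    exact abs_le_max_one_of_pow_four_le h4
  set zh : ℝ → PhaseSpace N := fun σ => limitChainFlow μ 1 N hR xs σ with hzh
  have hzhc : Continuous zh := continuous_limitChainFlow_right μ 1 N hR xs
  have hzhIE : IsIntegralSolutionOn Yhat (fun _ => xs) zh 1 := fun σ hσ =>
    limitChainFlow_eq_add_integral N hR hμ.le zero_le_one (h₀ := 2) (ρ := ρ) (Λ := 1) hRad hHxs hxsρ hσ
  have hzhmem : ∀ σ ∈ Icc (0 : ℝ) 1, zh σ ∈ scaleRegion μ N Cp Cd Cq := by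
    intro σ _
    have hb := limitChainFlow_one_bounds hμ.le N hR hHxs σ
    exact ⟨hb.1, hb.2.1, hb.2.2⟩
  -- (e) Grönwall
  have hLip := lipschitzOnWith_limitChain_drift (N := N) hμ.le zero_le_one (Cp := Cp) (Cd := Cd) hCq0
  have hclose : ∀ σ ∈ Icc (0 : ℝ) 1, ‖zs σ - zh σ‖ ≤ (1 + Cpert) / K * Real.exp (L * 1) := by
    intro σ hσ
    have h := IsIntegralSolutionOn.norm_sub_le_mul_exp hLip hGIE hzhIE hzsc hzhc hmem hzhmem
      (δ := (1 + Cpert) / K) (fun t ht => by simpa using hGδ t ht) σ hσ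
    refine h.trans (mul_le_mul_of_nonneg_left ?_ (by positivity))
    rw [Real.coe_toNNReal _ hL0]
    exact Real.exp_le_exp.2 (mul_le_mul_of_nonneg_left hσ.2 hL0)
  -- (f) dissipation of the reference
  have hFxs : ε₁ ≤ limitDissipation μ 1 N hR 1 xs := hF xs hHxs1 hHxs hxsρ
  -- (g) transfer to the rescaled smooth momenta `K⁻² ȳ(σ/K)`
  set ys : ℝ → Fin N → ℝ := fun σ i =>
    (K ^ 2)⁻¹ * (z (σ / K) - ((0 : Fin N → ℝ), η (σ / K))).2 i with hys
  have hΔ : ∀ σ ∈ Icc (0 : ℝ) 1, ∀ i, |ys σ i - (limitChainFlow μ 1 N hR xs σ).2 i| ≤ D₀ / K := by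
    intro σ hσ i
    have h1 : |(zs σ).2 i - ys σ i| ≤ 1 / K := (hbd σ hσ).2.2.2 i
    have h2 : |(zs σ).2 i - (zh σ).2 i| ≤ (1 + Cpert) / K * Real.exp (L * 1) := by
      have := hclose σ hσ
      calc |(zs σ).2 i - (zh σ).2 i| = |(zs σ - zh σ).2 i| := by simp
        _ ≤ ‖zs σ - zh σ‖ := by
            rw [← Real.norm_eq_abs]; exact (norm_le_pi_norm (zs σ - zh σ).2 i).trans (norm_snd_le _)
        _ ≤ _ := this
    have h3 : (zh σ).2 i = (limitChainFlow μ 1 N hR xs σ).2 i := rfl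
    rw [← h3]
    calc |ys σ i - (zh σ).2 i| = |((zs σ).2 i - (zh σ).2 i) - ((zs σ).2 i - ys σ i)| := by ring_nf
      _ ≤ |(zs σ).2 i - (zh σ).2 i| + |(zs σ).2 i - ys σ i| := abs_sub _ _
      _ ≤ (1 + Cpert) / K * Real.exp (L * 1) + 1 / K := add_le_add h2 h1
      _ = D₀ / K := by rw [hD₀]; ring
  have hw0 : ∀ i, 0 ≤ bathWeight N i := fun i => by unfold bathWeight; split_ifs <;> norm_num
  have hpt : ∀ σ ∈ Icc (0 : ℝ) 1, (1 / 2) * (∑ i, bathWeight N i * (limitChainFlow μ 1 N hR xs σ).2 i ^ 2) -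
      2 * (D₀ / K) ^ 2 ≤ ∑ i, bathWeight N i * ys σ i ^ 2 := by
    intro σ hσ
    have h1 : ∀ i, bathWeight N i * ((limitChainFlow μ 1 N hR xs σ).2 i ^ 2 / 2 - (D₀ / K) ^ 2) ≤
        bathWeight N i * ys σ i ^ 2 := by
      intro i
      refine mul_le_mul_of_nonneg_left ?_ (hw0 i)
      have h := half_sq_sub_sq_le (ys σ i) ((limitChainFlow μ 1 N hR xs σ).2 i)
      have hd : (ys σ i - (limitChainFlow μ 1 N hR xs σ).2 i) ^ 2 ≤ (D₀ / K) ^ 2 := by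
        rw [← sq_abs]; exact pow_le_pow_left₀ (abs_nonneg _) (hΔ σ hσ i) 2
      linarith
    have h2 := Finset.sum_le_sum fun i (_ : i ∈ Finset.univ) => h1 i
    have h3 : ∑ i, bathWeight N i * ((limitChainFlow μ 1 N hR xs σ).2 i ^ 2 / 2 - (D₀ / K) ^ 2) =
        (1 / 2) * (∑ i, bathWeight N i * (limitChainFlow μ 1 N hR xs σ).2 i ^ 2) -
          (∑ i, bathWeight N i) * (D₀ / K) ^ 2 := by
      rw [Finset.mul_sum, Finset.sum_mul, ← Finset.sum_sub_distrib]
      exact Finset.sum_congr rfl fun i _ => by ring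
    rw [h3, sum_bathWeight hN] at h2
    exact h2
  -- integrate over `[0, 1]`
  have hysc : Continuous fun σ => ∑ i, bathWeight N i * ys σ i ^ 2 := by
    have hc1 : Continuous fun σ => z (σ / K) - ((0 : Fin N → ℝ), η (σ / K)) :=
      (hzc.comp (continuous_id.div_const K)).sub
        (continuous_const.prodMk (hη.comp (continuous_id.div_const K)))
    refine continuous_finsetSum _ fun i _ => continuous_const.mul ?_
    exact (continuous_const.mul ((continuous_apply i).comp (continuous_snd.comp hc1))).pow 2
  have hlimc : Continuous fun σ => ∑ i, bathWeight N i * (limitChainFlow μ 1 N hR xs σ).2 i ^ 2 :=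
    (continuous_limitDissipation_integrand μ 1 N hR).comp (Continuous.prodMk_right xs)
  have hint : ε₁ / 4 ≤ ∫ σ in (0 : ℝ)..1, ∑ i, bathWeight N i * ys σ i ^ 2 := by
    have h1 : ∫ σ in (0 : ℝ)..1, ((1 / 2) * (∑ i, bathWeight N i * (limitChainFlow μ 1 N hR xs σ).2 i ^ 2) -
        2 * (D₀ / K) ^ 2) ≤ ∫ σ in (0 : ℝ)..1, ∑ i, bathWeight N i * ys σ i ^ 2 :=
      intervalIntegral.integral_mono_on zero_le_one
        (((hlimc.const_mul _).sub continuous_const).intervalIntegrable _ _)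
        (hysc.intervalIntegrable _ _) fun σ hσ => hpt σ hσ
    rw [intervalIntegral.integral_sub ((hlimc.const_mul _).intervalIntegrable _ _)
      (continuous_const.intervalIntegrable _ _), intervalIntegral.integral_const_mul,
      intervalIntegral.integral_const, sub_zero, smul_eq_mul, one_mul] at h1
    unfold limitDissipation at hFxs
    have h3 : 2 * (D₀ / K) ^ 2 ≤ ε₁ / 4 := by
      have hK2 : K ≤ K ^ 2 := by nlinarith only [hK1]
      have h4 : 8 * D₀ ^ 2 ≤ ε₁ * K := by
        have := mul_le_mul_of_nonneg_left hKD hε₁.le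
        rwa [mul_div_cancel₀ _ hε₁.ne'] at this
      have h6 : ε₁ * K ≤ ε₁ * K ^ 2 := mul_le_mul_of_nonneg_left hK2 hε₁.le
      rw [div_pow]
      have h5 : 2 * (D₀ ^ 2 / K ^ 2) = 2 * D₀ ^ 2 / K ^ 2 := by ring
      rw [h5, div_le_iff₀ (by positivity)]
      linarith only [h4, h6]
    linarith only [h1, h3, hFxs]
  -- (h) back to the original time: `∫₀^{1/K} ∑ w ȳ² = K³ ∫₀^1 ∑ w (K⁻²ȳ(σ/K))²`
  have hunscale : ∫ s in (0 : ℝ)..1 / K, ∑ i, bathWeight N i *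
      (z s - ((0 : Fin N → ℝ), η s)).2 i ^ 2 = K ^ 3 * ∫ σ in (0 : ℝ)..1, ∑ i, bathWeight N i * ys σ i ^ 2 := by
    have h1 : ∀ σ, ∑ i, bathWeight N i * ys σ i ^ 2 =
        (K ^ 4)⁻¹ * ∑ i, bathWeight N i * (z (σ / K) - ((0 : Fin N → ℝ), η (σ / K))).2 i ^ 2 := by
      intro σ
      rw [Finset.mul_sum]
      refine Finset.sum_congr rfl fun i _ => ?_
      simp only [hys]
      have : (K ^ 4)⁻¹ = (K ^ 2)⁻¹ * (K ^ 2)⁻¹ := by rw [← mul_inv, ← pow_add]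
      rw [this]; ring
    simp_rw [h1]
    rw [intervalIntegral.integral_const_mul,
      intervalIntegral.integral_comp_div (fun s => ∑ i, bathWeight N i *
        (z s - ((0 : Fin N → ℝ), η s)).2 i ^ 2) hK0.ne', zero_div, smul_eq_mul]
    field_simp
  rw [hunscale]
  have hγK : 0 ≤ γ * K ^ 3 := by positivity
  calc γ * ε₁ / 4 * K ^ 3 = γ * K ^ 3 * (ε₁ / 4) := by ring
    _ ≤ γ * K ^ 3 * ∫ σ in (0 : ℝ)..1, ∑ i, bathWeight N i * ys σ i ^ 2 :=
        mul_le_mul_of_nonneg_left hint hγK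
    _ = γ * (K ^ 3 * ∫ σ in (0 : ℝ)..1, ∑ i, bathWeight N i * ys σ i ^ 2) := by ring

end Main

end Literature.MathematicalPhysics.KineticTheory.HeatConduction
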